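import Summits.ABC.IUTFork.Conditional.AbcOfCor312SlackRecut
import Summits.ABC.IUTFork.Conditional.AbcOfSHSigmaWindow
import HarnessLib

/-!
# The Σ-VARIANT CERTIFICATE `abc_of_SHSigma_v10K_window`, RECUT (rh-lead RULING R14 (3)): every per-datum binder CUT TO THE SZPIRO-BAD LOCUS
# (as the C lane's cut of record p450130 / p453137) and the cone binder `hreg ↦ hregBad` (p452637 / p453137 VERBATIM)

PROOF-ONLY sequel (no `def`, no new `Prop`, no instance, no notation; nothing re-typed) of this seat's `Conditional/AbcOfSHSigmaWindow.lean`
(abc-iut-rh2-q2-cond gen 0, p470285: `GenuineK.cor312Slack_of_statementSlack`, `abc_of_SHSigma_v10K_window`) and `Conditional/AbcOfCor312SlackRecut.lean`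
(gen 2, p476943: `Cor312Slack.ABC_of_cor312Slack_szpiroBad_hregBad`). abc-iut-rh2-q2-cond gen 2. TAKES NO SIDE on [IUTchIII] Cor. 3.12 or on any author.

WHY. `abc_of_SHSigma_v10K_window` (p470285; and its sequels `abc_of_SHSigma_v10K_windowP1` p473894, abc-iut-rp-m2's row-8 instance p475027) rides
p469667's `Cor312Slack.ABC_of_cor312Slack_of_hullRegime` and therefore carries the BLANKET cone binder `hreg`, KERNEL-REFUTED as typed by
`Conditional.not_hreg_v4` (p453135) — a composition record, VACUOUS AS TYPED in [CONE] (rh-ref-3 2026-08-26T22:55:30Z; R14 (1)). This file re-derives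
it on the recut core with EVERY per-datum binder cut to the SZPIRO-BAD admissible `(P, l)` — the antecedent of abc-iut-c312-d1's
`Cor22.forall_cor312Of_of_szpiroBad` «`(l+5)/4 < d_mod ∨ (6l(l+5−4d_mod)/((l+4)(l−3)))·(log-diff + (1−1/l)·log-cond) + (6l(l+5)/((l+4)(l−3)))·log π <
log q^{∤{2,l}}(λ)`» inserted after (P6) and before `∀ T`, EXACTLY where abc-iut-s2-p2's `abc_of_SH_v10K_window_szpiroBadAll` (p453137, the C lane's
certificate of record) inserts it into `hSHwBad` / `hNumBad` / `hregBad`: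

* **`abc_of_SHSigma_v10K_window_szpiroBad_hregBad`** — DATA binders = p470285's VERBATIM; explicit 5 = [S_H, WINDOW∩Σ, bad] `hSHswBad` (= p453137's
  `hSHwBad` additionally guarded by `σ P l T`) · [S_H|Σ-SLACK, WINDOW∖Σ, bad] `hSlackwBad` · [TOL, WINDOW∖Σ, bad] `hTolBad` · [NUM, DEEP, bad] `hNumBad`
  (= p453137's `hNumBad` VERBATIM) · [CONE, bad] `hregBad` (= p452637 / p453137 VERBATIM) ⟹ `ABC`. Text diff against p470285 = the one antecedent,
  five times; proof = p470285's per-datum step verbatim (Θ-side identification abc-iut-s2-p6's THEOREM p447368; window ∩ Σ through abc-iut-C-cert-3's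
  `GenuineK.cor312Of_of_SH`; window ∖ Σ through `GenuineK.cor312Slack_of_statementSlack`; deep through `hNumBad`) fed to
  `Cor312Slack.ABC_of_cor312Slack_szpiroBad_hregBad` with `ε := min (max R 0) Tol`. SPECIALISATIONS: `σ ≡ True` is p453137 itself up to the vacuous
  `hSlackwBad` / `hTolBad`; every binder is WEAKER-OR-EQUAL than p470285's (premise drop), so the theorem is STRONGER-OR-EQUAL, and at every
  Szpiro-GOOD admissible `(P, l)` NOTHING of any class is assumed (inside the core recut, nothing is assumed off the content locus of the display either).

READING (numbers unchanged, R14 (2)/(5)): `Tol(P,l) = ((l+1)/4)·5·d*_mod·l = 691200·d_mod·l(l+1)` in the currency of `−|log(Θ)|`, print's display /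
`H_unif = 2^140` / `C_K` UNCHANGED. HONEST SCOPE as p470285 / p453137: `hSHswBad` / `hSlackwBad` are not known to be satisfiable at every Szpiro-bad window
datum of their stratum; `hNumBad` and the weakened statement are ASSUMPTION LABELS for the disputed inequality; `hregBad` an assumption label for the
(U)-reading hull estimate, neither proved nor refuted as typed; the discharged `hΘ` is an UPPER bound on OUR typed hull volume by OUR genuine number.
«`ABC` follows from these hypotheses AS TYPED», nothing more; nothing here asserts that abc is proved or refuted or takes a side on any author
(Mochizuki / Scholze–Stix / Joshi / Dupuy–Hilado); refuted-as-typed ≠ refuted-in-print; typed ≠ proved; instantiated ≠ endorsed.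
[claim: Mochizuki2012, status: disputed] [cite: Mochizuki2012, IUTchIII Cor. 3.12 p. 173–174, Step (xi) p. 183–184; IUTchIV Thm. 1.10 p. 22–31, Cor. 2.2 (ii) p. 41–48]
[cite: DupuyHilado2025, §3.3–§3.4, Thm. 3.10.1]
-/

noncomputable section

open Set Function NumberField IsDedekindDomain

namespace Summit.ABC.IUTFork.Conditional

open Thm311 Thm311.Real Cor312 Cor312Vol Cor312Prov Literature.IUT.LogThetaLattice Literature.IUT.LogVolume
  Literature.IUT.HodgeTheaters Literature.IUT.LogVolume.ThetaData
open Literature.NumberTheory.DiophantineGeometry.GenEll Summit.ABC.ABC.Theorems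

/-- **`abc_of_SHSigma_v10K_window_szpiroBad_hregBad`** — the Σ-VARIANT of the certificate of record, RECUT (R14): for a stratum `σ` of the undecided
window and a remainder `R`, at SZPIRO-BAD admissible `(P, l)` only: [S_H, WINDOW∩Σ] the FULL hull-level clause at the chosen realising ideles / pinned
reading off the depth locus and in `σ` (p453137's `hSHwBad` + `σ`) · [S_H|Σ-SLACK, WINDOW∖Σ] the WEAKENED Statement `↑(−|log(q)| − R) ≤ −|log(Θ)|` at the
same setting off the locus and not in `σ` · [TOL, WINDOW∖Σ] `R ≤ ((l+1)/4)·5·d*_mod·l` there · [NUM, DEEP] `T.Cor312Of` on the locus (p453137's `hNumBad`)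
· [CONE] `hregBad` (p452637 / p453137 VERBATIM); the Θ-side identification is abc-iut-s2-p6's THEOREM p447368 inside. Explicit 5, all Szpiro-bad-cut; with
`σ ≡ True` it is p453137 (explicit 3). Rides `Cor312Slack.ABC_of_cor312Slack_szpiroBad_hregBad` (p476943). «`ABC` follows from these hypotheses as typed,
with no constant of the chain of record changed» — no side taken on [IUTchIII] Cor. 3.12; typed ≠ proved; instantiated ≠ endorsed.
[claim: Mochizuki2012, status: disputed] [cite: Mochizuki2012, IUTchIII Cor. 3.12 p. 173–174; IUTchIV Thm. 1.10 p. 22–31] [cite: DupuyHilado2025, §3.4] -/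
theorem abc_of_SHSigma_v10K_window_szpiroBad_hregBad
    (M : ∀ (P : NFPoint) (l : ℕ) (T : Cor22.ThetaVolumeDatumAt P l), Type) [∀ P l T, Field (M P l T)] [∀ P l T, NumberField (M P l T)]
    (archPk : ∀ (P : NFPoint) (l : ℕ) (T : Cor22.ThetaVolumeDatumAt P l), letI := T.instFieldF; letI := T.instNumberFieldF; letI := T.instAlgebraF; letI := T.instFieldK;
        letI := T.instNumberFieldK; letI := T.instAlgebraK; letI := T.instFieldFbar; letI := T.instAlgebraFbar;
        letI := T.instAlgebraKFbar; letI := T.instIsElliptic;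
      ∀ (j : (thetaIndex (pilotDataOfK T.D T.K)).Label) (vQ : (thetaIndex (pilotDataOfK T.D T.K)).VQ), Set ((logShellsDH (pilotDataOfK T.D T.K) (analyticLogv T.K)).Packet j vQ))
    (archSub : ∀ (P : NFPoint) (l : ℕ) (T : Cor22.ThetaVolumeDatumAt P l), letI := T.instFieldF; letI := T.instNumberFieldF; letI := T.instAlgebraF; letI := T.instFieldK;
        letI := T.instNumberFieldK; letI := T.instAlgebraK; letI := T.instFieldFbar; letI := T.instAlgebraFbar;
        letI := T.instAlgebraKFbar; letI := T.instIsElliptic;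
      ∀ (j : (thetaIndex (pilotDataOfK T.D T.K)).Label) (v : (thetaIndex (pilotDataOfK T.D T.K)).V), Set ((logShellsDH (pilotDataOfK T.D T.K) (analyticLogv T.K)).Packet j ((thetaIndex (pilotDataOfK T.D T.K)).over v)))
    (Ψ : ∀ (P : NFPoint) (l : ℕ) (T : Cor22.ThetaVolumeDatumAt P l), letI := T.instFieldF; letI := T.instNumberFieldF; letI := T.instAlgebraF; letI := T.instFieldK;
        letI := T.instNumberFieldK; letI := T.instAlgebraK; letI := T.instFieldFbar; letI := T.instAlgebraFbar;
        letI := T.instAlgebraKFbar; letI := T.instIsElliptic;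
      ℤ → ∀ v : (thetaIndex (pilotDataOfK T.D T.K)).V, v ∈ (thetaIndex (pilotDataOfK T.D T.K)).Vbad → Set ((logShellsDH (pilotDataOfK T.D T.K) (analyticLogv T.K)).StarPacket v))
    (act : ∀ (P : NFPoint) (l : ℕ) (T : Cor22.ThetaVolumeDatumAt P l), letI := T.instFieldF; letI := T.instNumberFieldF; letI := T.instAlgebraF; letI := T.instFieldK;
        letI := T.instNumberFieldK; letI := T.instAlgebraK; letI := T.instFieldFbar; letI := T.instAlgebraFbar;
        letI := T.instAlgebraKFbar; letI := T.instIsElliptic;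
      ℤ → ∀ v : (thetaIndex (pilotDataOfK T.D T.K)).V, v ∈ (thetaIndex (pilotDataOfK T.D T.K)).Vbad → (logShellsDH (pilotDataOfK T.D T.K) (analyticLogv T.K)).StarPacket v → Module.End ℚ ((logShellsDH (pilotDataOfK T.D T.K) (analyticLogv T.K)).StarPacket v))
    (Mmod : ∀ (P : NFPoint) (l : ℕ) (T : Cor22.ThetaVolumeDatumAt P l), letI := T.instFieldF; letI := T.instNumberFieldF; letI := T.instAlgebraF; letI := T.instFieldK;
        letI := T.instNumberFieldK; letI := T.instAlgebraK; letI := T.instFieldFbar; letI := T.instAlgebraFbar;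
        letI := T.instAlgebraKFbar; letI := T.instIsElliptic;
      ℤ → ∀ j : (thetaIndex (pilotDataOfK T.D T.K)).LabelStar, Set ((logShellsDH (pilotDataOfK T.D T.K) (analyticLogv T.K)).GlobalPacket j.1))
    (region : ∀ (P : NFPoint) (l : ℕ) (T : Cor22.ThetaVolumeDatumAt P l), letI := T.instFieldF; letI := T.instNumberFieldF; letI := T.instAlgebraF; letI := T.instFieldK;
        letI := T.instNumberFieldK; letI := T.instAlgebraK; letI := T.instFieldFbar; letI := T.instAlgebraFbar;
        letI := T.instAlgebraKFbar; letI := T.instIsElliptic;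
      ℤ → ∀ j : (thetaIndex (pilotDataOfK T.D T.K)).LabelStar, FinDivisor (M P l T) → ∀ vQ : (thetaIndex (pilotDataOfK T.D T.K)).VQ, Set ((logShellsDH (pilotDataOfK T.D T.K) (analyticLogv T.K)).Packet j.1 vQ))
    (frobAdm : ∀ (P : NFPoint) (l : ℕ) (T : Cor22.ThetaVolumeDatumAt P l), letI := T.instFieldF; letI := T.instNumberFieldF; letI := T.instAlgebraF; letI := T.instFieldK;
        letI := T.instNumberFieldK; letI := T.instAlgebraK; letI := T.instFieldFbar; letI := T.instAlgebraFbar;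
        letI := T.instAlgebraKFbar; letI := T.instIsElliptic;
      ℤ → ℤ → ∀ (j : (thetaIndex (pilotDataOfK T.D T.K)).Label) (vQ : (thetaIndex (pilotDataOfK T.D T.K)).VQ), Set ((logShellsDH (pilotDataOfK T.D T.K) (analyticLogv T.K)).Packet j vQ) → Prop)
    (frobLogvol : ∀ (P : NFPoint) (l : ℕ) (T : Cor22.ThetaVolumeDatumAt P l), letI := T.instFieldF; letI := T.instNumberFieldF; letI := T.instAlgebraF; letI := T.instFieldK;
        letI := T.instNumberFieldK; letI := T.instAlgebraK; letI := T.instFieldFbar; letI := T.instAlgebraFbar;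
        letI := T.instAlgebraKFbar; letI := T.instIsElliptic;
      ℤ → ℤ → ∀ (j : (thetaIndex (pilotDataOfK T.D T.K)).Label) (vQ : (thetaIndex (pilotDataOfK T.D T.K)).VQ), Set ((logShellsDH (pilotDataOfK T.D T.K) (analyticLogv T.K)).Packet j vQ) → ℝ)
    (frobΨ : ∀ (P : NFPoint) (l : ℕ) (T : Cor22.ThetaVolumeDatumAt P l), letI := T.instFieldF; letI := T.instNumberFieldF; letI := T.instAlgebraF; letI := T.instFieldK;
        letI := T.instNumberFieldK; letI := T.instAlgebraK; letI := T.instFieldFbar; letI := T.instAlgebraFbar;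
        letI := T.instAlgebraKFbar; letI := T.instIsElliptic;
      ℤ → ℤ → ∀ v : (thetaIndex (pilotDataOfK T.D T.K)).V, v ∈ (thetaIndex (pilotDataOfK T.D T.K)).Vbad → Set ((logShellsDH (pilotDataOfK T.D T.K) (analyticLogv T.K)).StarPacket v))
    (frobMmod : ∀ (P : NFPoint) (l : ℕ) (T : Cor22.ThetaVolumeDatumAt P l), letI := T.instFieldF; letI := T.instNumberFieldF; letI := T.instAlgebraF; letI := T.instFieldK;
        letI := T.instNumberFieldK; letI := T.instAlgebraK; letI := T.instFieldFbar; letI := T.instAlgebraFbar;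
        letI := T.instAlgebraKFbar; letI := T.instIsElliptic;
      ℤ → ℤ → ∀ j : (thetaIndex (pilotDataOfK T.D T.K)).LabelStar, Set ((logShellsDH (pilotDataOfK T.D T.K) (analyticLogv T.K)).GlobalPacket j.1))
    (unitImage : ∀ (P : NFPoint) (l : ℕ) (T : Cor22.ThetaVolumeDatumAt P l), letI := T.instFieldF; letI := T.instNumberFieldF; letI := T.instAlgebraF; letI := T.instFieldK;
        letI := T.instNumberFieldK; letI := T.instAlgebraK; letI := T.instFieldFbar; letI := T.instAlgebraFbar;
        letI := T.instAlgebraKFbar; letI := T.instIsElliptic;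
      ℤ → ℤ → ℕ → ∀ (j : (thetaIndex (pilotDataOfK T.D T.K)).Label) (vQ : (thetaIndex (pilotDataOfK T.D T.K)).VQ), Set ((logShellsDH (pilotDataOfK T.D T.K) (analyticLogv T.K)).Packet j vQ))
    (ballImage : ∀ (P : NFPoint) (l : ℕ) (T : Cor22.ThetaVolumeDatumAt P l), letI := T.instFieldF; letI := T.instNumberFieldF; letI := T.instAlgebraF; letI := T.instFieldK;
        letI := T.instNumberFieldK; letI := T.instAlgebraK; letI := T.instFieldFbar; letI := T.instAlgebraFbar;
        letI := T.instAlgebraKFbar; letI := T.instIsElliptic;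
      ℤ → ℤ → ∀ (j : (thetaIndex (pilotDataOfK T.D T.K)).Label) (vQ : (thetaIndex (pilotDataOfK T.D T.K)).VQ), Set ((logShellsDH (pilotDataOfK T.D T.K) (analyticLogv T.K)).Packet j vQ))
    (thetaDiv : ∀ (P : NFPoint) (l : ℕ) (T : Cor22.ThetaVolumeDatumAt P l), letI := T.instFieldF; letI := T.instNumberFieldF; letI := T.instAlgebraF; letI := T.instFieldK;
        letI := T.instNumberFieldK; letI := T.instAlgebraK; letI := T.instFieldFbar; letI := T.instAlgebraFbar;
        letI := T.instAlgebraKFbar; letI := T.instIsElliptic;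
      ℤ → ℤ → LgpDivisor (M P l T) (thetaIndex (pilotDataOfK T.D T.K)).lstar)
    (n : ∀ (P : NFPoint) (l : ℕ) (T : Cor22.ThetaVolumeDatumAt P l), ℤ)
    {HT : ∀ (P : NFPoint) (l : ℕ) (T : Cor22.ThetaVolumeDatumAt P l), Type} {LogLink : ∀ (P : NFPoint) (l : ℕ) (T : Cor22.ThetaVolumeDatumAt P l), HT P l T → HT P l T → Type}
    {IsFull : ∀ (P : NFPoint) (l : ℕ) (T : Cor22.ThetaVolumeDatumAt P l), ∀ {s t : HT P l T}, LogLink P l T s t → Prop}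
    (lat : ∀ (P : NFPoint) (l : ℕ) (T : Cor22.ThetaVolumeDatumAt P l), LGPGaussianLogThetaLattice (LogLink P l T) (IsFull P l T))
    {Frd : ∀ (P : NFPoint) (l : ℕ) (T : Cor22.ThetaVolumeDatumAt P l), Type} {IsoF : ∀ (P : NFPoint) (l : ℕ) (T : Cor22.ThetaVolumeDatumAt P l), Frd P l T → Frd P l T → Type} {Ob : ∀ (P : NFPoint) (l : ℕ) (T : Cor22.ThetaVolumeDatumAt P l), Frd P l T → Type}
    {realify : ∀ (P : NFPoint) (l : ℕ) (T : Cor22.ThetaVolumeDatumAt P l), Frd P l T → Frd P l T} {Strip : ∀ (P : NFPoint) (l : ℕ) (T : Cor22.ThetaVolumeDatumAt P l), Type} {IsoS : ∀ (P : NFPoint) (l : ℕ) (T : Cor22.ThetaVolumeDatumAt P l), Strip P l T → Strip P l T → Type}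
    {Mv : ∀ (P : NFPoint) (l : ℕ) (T : Cor22.ThetaVolumeDatumAt P l), letI := T.instFieldF; letI := T.instNumberFieldF; letI := T.instAlgebraF; letI := T.instFieldK;
        letI := T.instNumberFieldK; letI := T.instAlgebraK; letI := T.instFieldFbar; letI := T.instAlgebraFbar;
        letI := T.instAlgebraKFbar; letI := T.instIsElliptic;
      ∀ v : (thetaIndex (pilotDataOfK T.D T.K)).V, v ∈ (thetaIndex (pilotDataOfK T.D T.K)).Vbad → Type}
    [∀ P l T v h, Monoid (Mv P l T v h)]
    (sig : ∀ (P : NFPoint) (l : ℕ) (T : Cor22.ThetaVolumeDatumAt P l), letI := T.instFieldF; letI := T.instNumberFieldF; letI := T.instAlgebraF; letI := T.instFieldK;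
        letI := T.instNumberFieldK; letI := T.instAlgebraK; letI := T.instFieldFbar; letI := T.instAlgebraFbar;
        letI := T.instAlgebraKFbar; letI := T.instIsElliptic;
      GlobalLGPFrobenioidSignature (thetaIndex (pilotDataOfK T.D T.K)).lstar (thetaIndex (pilotDataOfK T.D T.K)).V (· ∈ (thetaIndex (pilotDataOfK T.D T.K)).Vbad) (Frd P l T) (IsoF P l T) (Ob P l T) (realify P l T)
        (Strip P l T) (IsoS P l T) (Mv P l T))
    (split : ∀ (P : NFPoint) (l : ℕ) (T : Cor22.ThetaVolumeDatumAt P l), SplittingMonoids (Mv P l T))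
    {ObΔ : ∀ (P : NFPoint) (l : ℕ) (T : Cor22.ThetaVolumeDatumAt P l), Type} {N : ∀ (P : NFPoint) (l : ℕ) (T : Cor22.ThetaVolumeDatumAt P l), letI := T.instFieldF; letI := T.instNumberFieldF; letI := T.instAlgebraF; letI := T.instFieldK;
        letI := T.instNumberFieldK; letI := T.instAlgebraK; letI := T.instFieldFbar; letI := T.instAlgebraFbar;
        letI := T.instAlgebraKFbar; letI := T.instIsElliptic;
      ∀ v : (thetaIndex (pilotDataOfK T.D T.K)).V, v ∈ (thetaIndex (pilotDataOfK T.D T.K)).Vbad → Type}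
    [∀ P l T v h, Monoid (N P l T v h)] (qData : ∀ (P : NFPoint) (l : ℕ) (T : Cor22.ThetaVolumeDatumAt P l), QPilotData (ObΔ P l T) (N P l T))
    (qK : ∀ (P : NFPoint) (l : ℕ) (T : Cor22.ThetaVolumeDatumAt P l), letI := T.instFieldF; letI := T.instNumberFieldF; letI := T.instAlgebraF; letI := T.instFieldK;
        letI := T.instNumberFieldK; letI := T.instAlgebraK; letI := T.instFieldFbar; letI := T.instAlgebraFbar;
        letI := T.instAlgebraKFbar; letI := T.instIsElliptic;
      ∀ v : (thetaIndex (pilotDataOfK T.D T.K)).V, v ∈ (thetaIndex (pilotDataOfK T.D T.K)).Vbad → Set ((logShellsDH (pilotDataOfK T.D T.K) (analyticLogv T.K)).StarPacket v))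
    (σ : ∀ (P : NFPoint) (l : ℕ), Cor22.ThetaVolumeDatumAt P l → Prop) (R : ∀ (P : NFPoint) (l : ℕ), Cor22.ThetaVolumeDatumAt P l → ℝ)
    -- [S_H, WINDOW ∩ Σ, Szpiro-bad] the FULL hull-level clause (p453137's `hSHwBad` VERBATIM) ONLY at SZPIRO-BAD admissible data OFF the depth locus AND IN `σ`
    (hSHswBad : ∀ (P : NFPoint), P ∈ UP → ∀ (l : ℕ), l.Prime → 5 ≤ l →
      Cor22.AdmitsCore P → Cor22.CondP2 P l → Cor22.CondP5 P l → Cor22.CondP6 P l →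
      (((l : ℝ) + 5) / 4 < (Cor22.dmod P : ℝ) ∨
        6 * l * (((l : ℝ) + 5) - 4 * Cor22.dmod P) / (((l : ℝ) + 4) * ((l : ℝ) - 3))
            * (P.logDiff + (1 - 1 / (l : ℝ)) * Cor22.logCondAvoid P {2, l})
          + 6 * l * ((l : ℝ) + 5) / (((l : ℝ) + 4) * ((l : ℝ) - 3)) * Real.log Real.pi < Cor22.logQAvoid P {2, l}) →
      ∀ (T : Cor22.ThetaVolumeDatumAt P l), letI := T.instFieldF; letI := T.instNumberFieldF; letI := T.instAlgebraF; letI := T.instFieldK;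
        letI := T.instNumberFieldK; letI := T.instAlgebraK; letI := T.instFieldFbar; letI := T.instAlgebraFbar;
        letI := T.instAlgebraKFbar; letI := T.instIsElliptic;
      ¬ (∃ (pp : Nat.Primes) (_ : 2 < (pp : ℕ)) (i : Fin (thetaIndex (pilotDataOfK T.D T.K)).lstar)
          (x₀ : (thetaIndex (pilotDataOfK T.D T.K)).Fibre (.inr pp)),
        haveI : Fact (pp : ℕ).Prime := ⟨pp.2⟩
        ((pp : ℕ) : ℝ) ^ ((((i : ℕ) : ℝ) + 2) * (4 + 2 * Real.logb (pp : ℕ) (Module.finrank ℚ T.K)) + 1) *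
          ‖(exists_realising_qIdeles_pilotDataOfK T.D).choose pp x₀‖ ^ (((i : ℕ) + 1) ^ 2 - 1) < 1) → σ P l T →
      Cor312Vol.PilotKummerCompatHull
        (LatticeSituation.ofShells (logShellsDH (pilotDataOfK T.D T.K) (analyticLogv T.K)) (M P l T) (archPk P l T)
          (archSub P l T) (summandPiecesPr (pilotDataOfK T.D T.K) (logvAnalytic_analyticLogv (F := T.K))).Adm
          (summandPiecesPr (pilotDataOfK T.D T.K) (logvAnalytic_analyticLogv (F := T.K))).logvol (Ψ P l T) (act P l T) (Mmod P l T)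
          (region P l T) (frobAdm P l T) (frobLogvol P l T) (frobΨ P l T) (frobMmod P l T) (unitImage P l T)
          (ballImage P l T) (thetaDiv P l T))
        (settingPrVolSharp (pilotDataOfK T.D T.K) (logvAnalytic_analyticLogv (F := T.K)) (M P l T) (archPk P l T) (archSub P l T) (Ψ P l T)
          (act P l T) (Mmod P l T) (region P l T) (n P l T) (lat P l T) (sig P l T) (split P l T) (qData P l T)
          (exists_realising_qIdeles_pilotDataOfK T.D).choose
          (exists_realising_thetaIdeles_pilotDataOfK T.D).choose
          (exists_realising_qIdeles_pilotDataOfK T.D).choose_spec.1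
          (exists_realising_qIdeles_pilotDataOfK T.D).choose_spec.2.1)
        (fun _ => Cor312.Setting.qRegion
        (settingPrVolSharp (pilotDataOfK T.D T.K) (logvAnalytic_analyticLogv (F := T.K)) (M P l T) (archPk P l T) (archSub P l T) (Ψ P l T)
          (act P l T) (Mmod P l T) (region P l T) (n P l T) (lat P l T) (sig P l T) (split P l T) (qData P l T)
          (exists_realising_qIdeles_pilotDataOfK T.D).choose
          (exists_realising_thetaIdeles_pilotDataOfK T.D).choose
          (exists_realising_qIdeles_pilotDataOfK T.D).choose_spec.1
          (exists_realising_qIdeles_pilotDataOfK T.D).choose_spec.2.1)) (qK P l T))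
    -- [S_H|Σ-SLACK, WINDOW ∖ Σ, Szpiro-bad] the WEAKENED Statement at the chosen realising ideles with slack `R P l T`, ONLY at SZPIRO-BAD admissible data OFF the locus and NOT in `σ`
    (hSlackwBad : ∀ (P : NFPoint), P ∈ UP → ∀ (l : ℕ), l.Prime → 5 ≤ l →
      Cor22.AdmitsCore P → Cor22.CondP2 P l → Cor22.CondP5 P l → Cor22.CondP6 P l →
      (((l : ℝ) + 5) / 4 < (Cor22.dmod P : ℝ) ∨
        6 * l * (((l : ℝ) + 5) - 4 * Cor22.dmod P) / (((l : ℝ) + 4) * ((l : ℝ) - 3))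
            * (P.logDiff + (1 - 1 / (l : ℝ)) * Cor22.logCondAvoid P {2, l})
          + 6 * l * ((l : ℝ) + 5) / (((l : ℝ) + 4) * ((l : ℝ) - 3)) * Real.log Real.pi < Cor22.logQAvoid P {2, l}) →
      ∀ (T : Cor22.ThetaVolumeDatumAt P l), letI := T.instFieldF; letI := T.instNumberFieldF; letI := T.instAlgebraF; letI := T.instFieldK;
        letI := T.instNumberFieldK; letI := T.instAlgebraK; letI := T.instFieldFbar; letI := T.instAlgebraFbar;
        letI := T.instAlgebraKFbar; letI := T.instIsElliptic;
      ¬ (∃ (pp : Nat.Primes) (_ : 2 < (pp : ℕ)) (i : Fin (thetaIndex (pilotDataOfK T.D T.K)).lstar)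
          (x₀ : (thetaIndex (pilotDataOfK T.D T.K)).Fibre (.inr pp)),
        haveI : Fact (pp : ℕ).Prime := ⟨pp.2⟩
        ((pp : ℕ) : ℝ) ^ ((((i : ℕ) : ℝ) + 2) * (4 + 2 * Real.logb (pp : ℕ) (Module.finrank ℚ T.K)) + 1) *
          ‖(exists_realising_qIdeles_pilotDataOfK T.D).choose pp x₀‖ ^ (((i : ℕ) + 1) ^ 2 - 1) < 1) → ¬ σ P l T →
      ((((settingPrVolSharp (pilotDataOfK T.D T.K) (logvAnalytic_analyticLogv (F := T.K)) (M P l T) (archPk P l T) (archSub P l T) (Ψ P l T)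
          (act P l T) (Mmod P l T) (region P l T) (n P l T) (lat P l T) (sig P l T) (split P l T) (qData P l T)
          (exists_realising_qIdeles_pilotDataOfK T.D).choose
          (exists_realising_thetaIdeles_pilotDataOfK T.D).choose
          (exists_realising_qIdeles_pilotDataOfK T.D).choose_spec.1
          (exists_realising_qIdeles_pilotDataOfK T.D).choose_spec.2.1).negLogQ - R P l T : ℝ)) : WithTop ℝ) ≤
        (settingPrVolSharp (pilotDataOfK T.D T.K) (logvAnalytic_analyticLogv (F := T.K)) (M P l T) (archPk P l T) (archSub P l T) (Ψ P l T)
          (act P l T) (Mmod P l T) (region P l T) (n P l T) (lat P l T) (sig P l T) (split P l T) (qData P l T)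
          (exists_realising_qIdeles_pilotDataOfK T.D).choose
          (exists_realising_thetaIdeles_pilotDataOfK T.D).choose
          (exists_realising_qIdeles_pilotDataOfK T.D).choose_spec.1
          (exists_realising_qIdeles_pilotDataOfK T.D).choose_spec.2.1).negLogTheta)
    -- [TOL, WINDOW ∖ Σ, Szpiro-bad] the remainder is within the tolerance of `Cor312Slack.display_of_squeezeIII_slack'`, ONLY there
    (hTolBad : ∀ (P : NFPoint), P ∈ UP → ∀ (l : ℕ), l.Prime → 5 ≤ l →
      Cor22.AdmitsCore P → Cor22.CondP2 P l → Cor22.CondP5 P l → Cor22.CondP6 P l →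
      (((l : ℝ) + 5) / 4 < (Cor22.dmod P : ℝ) ∨
        6 * l * (((l : ℝ) + 5) - 4 * Cor22.dmod P) / (((l : ℝ) + 4) * ((l : ℝ) - 3))
            * (P.logDiff + (1 - 1 / (l : ℝ)) * Cor22.logCondAvoid P {2, l})
          + 6 * l * ((l : ℝ) + 5) / (((l : ℝ) + 4) * ((l : ℝ) - 3)) * Real.log Real.pi < Cor22.logQAvoid P {2, l}) →
      ∀ (T : Cor22.ThetaVolumeDatumAt P l), letI := T.instFieldF; letI := T.instNumberFieldF; letI := T.instAlgebraF; letI := T.instFieldK;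
        letI := T.instNumberFieldK; letI := T.instAlgebraK; letI := T.instFieldFbar; letI := T.instAlgebraFbar;
        letI := T.instAlgebraKFbar; letI := T.instIsElliptic;
      ¬ (∃ (pp : Nat.Primes) (_ : 2 < (pp : ℕ)) (i : Fin (thetaIndex (pilotDataOfK T.D T.K)).lstar)
          (x₀ : (thetaIndex (pilotDataOfK T.D T.K)).Fibre (.inr pp)),
        haveI : Fact (pp : ℕ).Prime := ⟨pp.2⟩
        ((pp : ℕ) : ℝ) ^ ((((i : ℕ) : ℝ) + 2) * (4 + 2 * Real.logb (pp : ℕ) (Module.finrank ℚ T.K)) + 1) *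
          ‖(exists_realising_qIdeles_pilotDataOfK T.D).choose pp x₀‖ ^ (((i : ℕ) + 1) ^ 2 - 1) < 1) → ¬ σ P l T → R P l T ≤ ((l : ℝ) + 1) / 4 * (5 * ((((2 ^ 12 * 3 ^ 3 * 5 * Cor22.dmod P : ℕ) : ℝ)) * l)))
    -- [NUM, DEEP, Szpiro-bad] the NUMBER-level Corollary 3.12 at the datum, ONLY at SZPIRO-BAD admissible data ON the depth locus (p453137's `hNumBad` VERBATIM)
    (hNumBad : ∀ (P : NFPoint), P ∈ UP → ∀ (l : ℕ), l.Prime → 5 ≤ l →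
      Cor22.AdmitsCore P → Cor22.CondP2 P l → Cor22.CondP5 P l → Cor22.CondP6 P l →
      (((l : ℝ) + 5) / 4 < (Cor22.dmod P : ℝ) ∨
        6 * l * (((l : ℝ) + 5) - 4 * Cor22.dmod P) / (((l : ℝ) + 4) * ((l : ℝ) - 3))
            * (P.logDiff + (1 - 1 / (l : ℝ)) * Cor22.logCondAvoid P {2, l})
          + 6 * l * ((l : ℝ) + 5) / (((l : ℝ) + 4) * ((l : ℝ) - 3)) * Real.log Real.pi < Cor22.logQAvoid P {2, l}) →
      ∀ (T : Cor22.ThetaVolumeDatumAt P l), letI := T.instFieldF; letI := T.instNumberFieldF; letI := T.instAlgebraF; letI := T.instFieldK;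
        letI := T.instNumberFieldK; letI := T.instAlgebraK; letI := T.instFieldFbar; letI := T.instAlgebraFbar;
        letI := T.instAlgebraKFbar; letI := T.instIsElliptic;
      (∃ (pp : Nat.Primes) (_ : 2 < (pp : ℕ)) (i : Fin (thetaIndex (pilotDataOfK T.D T.K)).lstar)
          (x₀ : (thetaIndex (pilotDataOfK T.D T.K)).Fibre (.inr pp)),
        haveI : Fact (pp : ℕ).Prime := ⟨pp.2⟩
        ((pp : ℕ) : ℝ) ^ ((((i : ℕ) : ℝ) + 2) * (4 + 2 * Real.logb (pp : ℕ) (Module.finrank ℚ T.K)) + 1) *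
          ‖(exists_realising_qIdeles_pilotDataOfK T.D).choose pp x₀‖ ^ (((i : ℕ) + 1) ^ 2 - 1) < 1) → T.Cor312Of)
    -- [CONE, Szpiro-bad] the off-regime hull estimate with `B_III(P,l)` ONLY at SZPIRO-BAD admissible `(P, l)` (p452637 / p453137 `hregBad` VERBATIM)
    (hregBad : ∀ P : NFPoint, P ∈ UP → ∀ l : ℕ, l.Prime → 5 ≤ l →
      Cor22.AdmitsCore P → Cor22.CondP2 P l → Cor22.CondP5 P l → Cor22.CondP6 P l →
      (((l : ℝ) + 5) / 4 < (Cor22.dmod P : ℝ) ∨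
        6 * l * (((l : ℝ) + 5) - 4 * Cor22.dmod P) / (((l : ℝ) + 4) * ((l : ℝ) - 3))
            * (P.logDiff + (1 - 1 / (l : ℝ)) * Cor22.logCondAvoid P {2, l})
          + 6 * l * ((l : ℝ) + 5) / (((l : ℝ) + 4) * ((l : ℝ) - 3)) * Real.log Real.pi < Cor22.logQAvoid P {2, l}) →
      ∀ T : Cor22.ThetaVolumeDatumAt P l,
        (letI := T.instFieldF; letI := T.instNumberFieldF; letI := T.instAlgebraF; letI := T.instFieldK
         letI := T.instNumberFieldK; letI := T.instAlgebraK; letI := T.instFieldFbar; letI := T.instAlgebraFbar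
         letI := T.instAlgebraKFbar; letI := T.instIsElliptic
         ¬ (∀ p ∈ T.I.supportPrimes, ∀ v w : placesOver (fieldOfModuli T.E) p,
            (Summit.ABC.IUTFork.DHData.ofInput T.I).logQloc p v = (Summit.ABC.IUTFork.DHData.ofInput T.I).logQloc p w)) →
        T.HullEstimateOf
          (((l : ℝ) + 1) / 4 *
            ((1 + 12 * (Cor22.dmod P : ℝ) / l) * (P.logDiff + Cor22.logCondAvoid P {2, l})
              + 2 * Real.log l + 52
              + 20 / 3 * Real.log (((2 ^ 12 * 3 ^ 3 * 5 * Cor22.dmod P : ℕ) : ℝ) * (l : ℝ))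
                * (Nat.primeCounting (2 ^ 12 * 3 ^ 3 * 5 * Cor22.dmod P * l) : ℝ))))
    : _root_.ABC := by
  refine Cor312Slack.ABC_of_cor312Slack_szpiroBad_hregBad
    (fun P l T => min (max (R P l T) 0) (((l : ℝ) + 1) / 4 * (5 * ((((2 ^ 12 * 3 ^ 3 * 5 * Cor22.dmod P : ℕ) : ℝ)) * l))))
    (fun P hP l hl h5 hc h2 h5' h6 hbad T => ?_) (fun P _ l _ _ _ _ _ _ _ T => min_le_right _ _) hregBad
  letI := T.instFieldF; letI := T.instNumberFieldF; letI := T.instAlgebraF; letI := T.instFieldK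
  letI := T.instNumberFieldK; letI := T.instAlgebraK; letI := T.instFieldFbar; letI := T.instAlgebraFbar
  letI := T.instAlgebraKFbar; letI := T.instIsElliptic
  have hTol0 : (0 : ℝ) ≤ ((l : ℝ) + 1) / 4 * (5 * ((((2 ^ 12 * 3 ^ 3 * 5 * Cor22.dmod P : ℕ) : ℝ)) * l)) := by positivity
  have hε0 : (0 : ℝ) ≤ min (max (R P l T) 0) (((l : ℝ) + 1) / 4 * (5 * ((((2 ^ 12 * 3 ^ 3 * 5 * Cor22.dmod P : ℕ) : ℝ)) * l))) :=
    le_min (le_max_right _ _) hTol0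
  -- the Θ-side identification at the chosen ideles is abc-iut-s2-p6's THEOREM p447368 (no depth / window / stratum condition)
  have hΘ := negLogTheta_settingPrVolSharp_pilotDataOfK_le_datum T (M P l T) (archPk P l T) (archSub P l T) (Ψ P l T) (act P l T)
    (Mmod P l T) (region P l T) (n P l T) (lat P l T) (sig P l T) (split P l T) (qData P l T)
    (exists_realising_qIdeles_pilotDataOfK T.D).choose (exists_realising_thetaIdeles_pilotDataOfK T.D).choose
    (exists_realising_qIdeles_pilotDataOfK T.D).choose_spec.1 (exists_realising_qIdeles_pilotDataOfK T.D).choose_spec.2.1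
    (exists_realising_thetaIdeles_pilotDataOfK T.D).choose_spec.1 (exists_realising_thetaIdeles_pilotDataOfK T.D).choose_spec.2.2
  by_cases hdeep : (∃ (pp : Nat.Primes) (_ : 2 < (pp : ℕ)) (i : Fin (thetaIndex (pilotDataOfK T.D T.K)).lstar)
          (x₀ : (thetaIndex (pilotDataOfK T.D T.K)).Fibre (.inr pp)),
        haveI : Fact (pp : ℕ).Prime := ⟨pp.2⟩
        ((pp : ℕ) : ℝ) ^ ((((i : ℕ) : ℝ) + 2) * (4 + 2 * Real.logb (pp : ℕ) (Module.finrank ℚ T.K)) + 1) *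
          ‖(exists_realising_qIdeles_pilotDataOfK T.D).choose pp x₀‖ ^ (((i : ℕ) + 1) ^ 2 - 1) < 1)
  · -- ON the depth locus: the number-level Corollary (slack `≥ 0`)
    have h := (hNumBad P hP l hl h5 hc h2 h5' h6 hbad T hdeep)
    rw [Cor22.ThetaVolumeDatumAt.cor312Of_iff] at h
    linarith
  by_cases hσ : σ P l T
  · -- window ∩ Σ: the FULL hull clause ⟹ the Corollary exactly (v5K's `GenuineK.cor312Of_of_SH`, pinned reading, `hΘ :=` p447368)
    have h : T.Cor312Of := GenuineK.cor312Of_of_SH T.D T.K (M P l T) (archPk P l T) (archSub P l T) (Ψ P l T) (act P l T) (Mmod P l T)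
      (region P l T) (frobAdm P l T) (frobLogvol P l T) (frobΨ P l T) (frobMmod P l T) (unitImage P l T) (ballImage P l T)
      (thetaDiv P l T) (n P l T) (lat P l T) (sig P l T) (split P l T) (qData P l T)
      (exists_realising_thetaIdeles_pilotDataOfK T.D).choose (exists_realising_qIdeles_pilotDataOfK T.D).choose
      (fun _ => Cor312.Setting.qRegion
          (settingPrVolSharp (pilotDataOfK T.D T.K) (logvAnalytic_analyticLogv (F := T.K)) (M P l T) (archPk P l T) (archSub P l T) (Ψ P l T)
          (act P l T) (Mmod P l T) (region P l T) (n P l T) (lat P l T) (sig P l T) (split P l T) (qData P l T)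
          (exists_realising_qIdeles_pilotDataOfK T.D).choose
          (exists_realising_thetaIdeles_pilotDataOfK T.D).choose
          (exists_realising_qIdeles_pilotDataOfK T.D).choose_spec.1
          (exists_realising_qIdeles_pilotDataOfK T.D).choose_spec.2.1)) (qK P l T)
      T.isVolumeInputOf (exists_realising_qIdeles_pilotDataOfK T.D).choose_spec.1
      (exists_realising_qIdeles_pilotDataOfK T.D).choose_spec.2.1 (exists_realising_thetaIdeles_pilotDataOfK T.D).choose_spec.1
      (exists_realising_thetaIdeles_pilotDataOfK T.D).choose_spec.2.1 (exists_realising_qIdeles_pilotDataOfK T.D).choose_spec.2.2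
      (hSHswBad P hP l hl h5 hc h2 h5' h6 hbad T hdeep hσ) (fun _ _ => rfl) hΘ
    rw [Cor22.ThetaVolumeDatumAt.cor312Of_iff] at h
    linarith
  · -- window ∖ Σ: the WEAKENED Statement with remainder `R` (§1, `hΘ :=` p447368), then the tolerance
    have h := GenuineK.cor312Slack_of_statementSlack T.D T.K (M P l T) (archPk P l T) (archSub P l T) (Ψ P l T) (act P l T) (Mmod P l T)
      (region P l T) (n P l T) (lat P l T) (sig P l T) (split P l T) (qData P l T)
      (exists_realising_thetaIdeles_pilotDataOfK T.D).choose (exists_realising_qIdeles_pilotDataOfK T.D).choose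
      T.isVolumeInputOf (exists_realising_qIdeles_pilotDataOfK T.D).choose_spec.1
      (exists_realising_qIdeles_pilotDataOfK T.D).choose_spec.2.1 (exists_realising_qIdeles_pilotDataOfK T.D).choose_spec.2.2
      (hSlackwBad P hP l hl h5 hc h2 h5' h6 hbad T hdeep hσ) hΘ
    have hR : R P l T ≤ min (max (R P l T) 0) (((l : ℝ) + 1) / 4 * (5 * ((((2 ^ 12 * 3 ^ 3 * 5 * Cor22.dmod P : ℕ) : ℝ)) * l))) :=
      le_min (le_max_left _ _) (hTolBad P hP l hl h5 hc h2 h5' h6 hbad T hdeep hσ)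
    have h' : T.negAbsLogQ ≤ T.negLogTheta + R P l T := h
    linarith

end Summit.ABC.IUTFork.Conditional

end
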